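import Summits.HodgeConjecture.HodgeConjecture.Theorems.Ring2WeilCoverageCMFieldCriteria
import HarnessLib

/-!
# Non-split Weil-type components over the BIQUADRATIC CM fields `ℚ(ζ₈)`, `ℚ(ζ₁₂)`, `ℚ(√-3,√5)`, `ℚ(i,√5)`

research route conditional on HC_CM; not a corollary; Q11.4-sentence-2 already refuted in dim ≥ 3.
Cell `pub-hodge-ring2`, seat `ring2-b03` (gen 47); kernel certificates for the Weil-type family-coverage
census `HOME/WEIL-FAMILY-COVERAGE.md` §b03.5 (operator priority5 2026-08-22T11:46:08Z): instances of
`Theorems/Ring2WeilCoverageCMFieldCriteria.lean` for the four `V₄` fields of the census, where NO Eisenstein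
prime and NO inert prime of residue degree `4` exists (a `V₄` quartic is reducible modulo every prime): the
carriers `S² + pS + q`, `T⁴ + pT² + q` are irreducible by factor exclusion (`p² - 4q = ℓ'm²` with `ℓ'`
prime), and every non-split class is obstructed at a PAIR of places over one rational prime `ℓ` split in `F`
and inert in `E/F` (`aniso_of_two_roots`: two non-square roots `k₁ ≠ k₂` of `R` mod `ℓ`, five `decide`s over
`𝔽_ℓ`). With this file EVERY non-split class `[n]`, `n ≤ 40`, of the four `V₄` tables of §b03.5 is decided
in the kernel: `ℚ(ζ₈)` (`R = S² + 6S + 1`): `7, 14, 21, 23, 28, 31, 35` (`ℓ = 7, 23, 31`); `ℚ(ζ₁₂)`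
(`S² + 8S + 4`; `E/F` unramified at every finite place): `11, 22, 23, 33` (`ℓ = 11, 23`); `ℚ(√-3,√5)`
(`S² + 9S + 9`): `11, 22, 29, 33` (`ℓ = 11, 29`); `ℚ(i,√5)` (`S² + 3S + 1`): `11, 19, 22, 31, 33, 38`
(`ℓ = 11, 19, 31`).

Dictionary (census §b03.5): `[ℓw] ≠ [(-1)²] = [1]` in `F^×/Nm_{E/F}(E^×)` says that the component `W8.E.[ℓw]`
(abelian eightfolds of Weil type `(2,2;2,2)` relative to `E`, `δ = disc φ = [ℓw]`) has no `E`-Lagrangian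
member (Deligne Cor. 4.2) — NON-SPLIT; `T([ℓw]) ⊇` both places of `F` over `ℓ` when `ℓ ∤ w`.

No named fact, no definition, no `sorry`; nothing about the Hodge conjecture is asserted.
References: [Deligne1982HodgeCycles] §4 p. 30 (1), Cor. 4.2, Lemma 4.6; [Landherr1936HermitianForms]. -/

noncomputable section

set_option linter.dupNamespace false

open Polynomial

namespace Summit.HodgeConjecture.HodgeConjecture.Ring2.WeilCoverageCM

open Literature.AlgebraicGeometry.Deligne1982
open Literature.AlgebraicGeometry.HodgeTheory (splitDiscriminantClassCM)

/-! ### §1 Discriminants: `p² - 4q = ℓ·m²` is not a rational square -/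

/-- `ℚ(ζ₈)`: `6² - 4·1 = 32 = 2·4²` is not a rational square. [folklore] -/
theorem disc_not_sq_six_one : ∀ r : ℚ, r ^ 2 ≠ ((6 : ℤ) : ℚ) ^ 2 - 4 * ((1 : ℤ) : ℚ) := fun r h =>
  rat_sq_ne_prime_mul_sq Nat.prime_two (m := 4) (by norm_num) r (by rw [h]; norm_num)

/-- `ℚ(ζ₁₂)`: `8² - 4·4 = 48 = 3·4²` is not a rational square. [folklore] -/
theorem disc_not_sq_eight_four : ∀ r : ℚ, r ^ 2 ≠ ((8 : ℤ) : ℚ) ^ 2 - 4 * ((4 : ℤ) : ℚ) := fun r h =>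
  rat_sq_ne_prime_mul_sq Nat.prime_three (m := 4) (by norm_num) r (by rw [h]; norm_num)

/-- `ℚ(√-3,√5)`: `9² - 4·9 = 45 = 5·3²` is not a rational square. [folklore] -/
theorem disc_not_sq_nine_nine : ∀ r : ℚ, r ^ 2 ≠ ((9 : ℤ) : ℚ) ^ 2 - 4 * ((9 : ℤ) : ℚ) := fun r h =>
  rat_sq_ne_prime_mul_sq (by norm_num : Nat.Prime 5) (m := 3) (by norm_num) r (by rw [h]; norm_num)

/-- `ℚ(i,√5)`: `3² - 4·1 = 5` is not a rational square. [folklore] -/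
theorem disc_not_sq_three_one : ∀ r : ℚ, r ^ 2 ≠ ((3 : ℤ) : ℚ) ^ 2 - 4 * ((1 : ℤ) : ℚ) := fun r h =>
  rat_sq_ne_prime_mul_sq (by norm_num : Nat.Prime 5) (m := 1) (by norm_num) r (by rw [h]; norm_num)

/-! ### §2 `E = ℚ(ζ₈) = ℚ(i,√2)`: `R = S² + 6S + 1` (`η = i(1+√2)`), `F = ℚ(√2)`; `ℓ = 7, 23, 31` -/

/-- **`[7w] ≠ [1]` for `E = ℚ(ζ₈)`, `7 ∤ w`**: `7` splits in `ℚ(√2)` (`σ ≡ 3, 5 mod 7`, both non-squares, i.e.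
both places over `7` inert in `E`); census rows `[7]`, `[14]`, `[21]`, `[28]`, `[35]` (`T = ` the two places
over `7`) are NON-SPLIT. [cite: Deligne1982HodgeCycles, §4 p. 30 (1) and Cor. 4.2] [cite: Landherr1936HermitianForms] -/
theorem zeta8_mk_seven_mul_ne_splitDiscriminantClassCM {R : Polynomial ℤ} (hR : R = X ^ 2 + C 6 * X + C 1)
    [Fact (Irreducible (realPolyQ R))] (w : ℤ) (hw : ¬ (7 : ℤ) ∣ w) (u : (realField R)ˣ)
    (hu : (u : realField R) = AdjoinRoot.of (realPolyQ R) (7 * w)) :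
    (QuotientGroup.mk u : cmNormResidueGroup R) ≠ splitDiscriminantClassCM R 2 := by
  exact mk_prime_mul_ne_splitDiscriminantClassCM_of_two_roots hR (by norm_num) (by norm_num)
    disc_not_sq_six_one 7 (by norm_num) 3 5 (by decide) (by decide) (by decide) (by decide) (by decide) w hw u
    (by rw [hu]; push_cast; ring_nf)

/-- **`[23w] ≠ [1]` for `E = ℚ(ζ₈)`, `23 ∤ w`** (`σ ≡ 10, 7 mod 23`, non-squares): census row `[23]`.
[cite: Deligne1982HodgeCycles, §4 p. 30 (1) and Cor. 4.2] -/
theorem zeta8_mk_twentyThree_mul_ne_splitDiscriminantClassCM {R : Polynomial ℤ}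
    (hR : R = X ^ 2 + C 6 * X + C 1) [Fact (Irreducible (realPolyQ R))] (w : ℤ) (hw : ¬ (23 : ℤ) ∣ w)
    (u : (realField R)ˣ) (hu : (u : realField R) = AdjoinRoot.of (realPolyQ R) (23 * w)) :
    (QuotientGroup.mk u : cmNormResidueGroup R) ≠ splitDiscriminantClassCM R 2 := by
  exact mk_prime_mul_ne_splitDiscriminantClassCM_of_two_roots hR (by norm_num) (by norm_num)
    disc_not_sq_six_one 23 (by norm_num) 10 7 (by decide) (by decide) (by decide) (by decide) (by decide) w hw u
    (by rw [hu]; push_cast; ring_nf)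

/-- **`[31w] ≠ [1]` for `E = ℚ(ζ₈)`, `31 ∤ w`** (`σ ≡ 13, 12 mod 31`, non-squares): census row `[31]`.
[cite: Deligne1982HodgeCycles, §4 p. 30 (1) and Cor. 4.2] -/
theorem zeta8_mk_thirtyOne_mul_ne_splitDiscriminantClassCM {R : Polynomial ℤ}
    (hR : R = X ^ 2 + C 6 * X + C 1) [Fact (Irreducible (realPolyQ R))] (w : ℤ) (hw : ¬ (31 : ℤ) ∣ w)
    (u : (realField R)ˣ) (hu : (u : realField R) = AdjoinRoot.of (realPolyQ R) (31 * w)) :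
    (QuotientGroup.mk u : cmNormResidueGroup R) ≠ splitDiscriminantClassCM R 2 := by
  exact mk_prime_mul_ne_splitDiscriminantClassCM_of_two_roots hR (by norm_num) (by norm_num)
    disc_not_sq_six_one 31 (by norm_num) 13 12 (by decide) (by decide) (by decide) (by decide) (by decide) w hw u
    (by rw [hu]; push_cast; ring_nf)

/-! ### §3 `E = ℚ(ζ₁₂) = ℚ(i,√3)`: `R = S² + 8S + 4` (`η = i(1+√3)`), `F = ℚ(√3)` (`E/F` unramified at
all finite places); `ℓ = 11, 23` -/

/-- **`[11w] ≠ [1]` for `E = ℚ(ζ₁₂)`, `11 ∤ w`** (`σ ≡ 8, 6 mod 11`, non-squares): census rows `[11]`, `[22]`,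
`[33]`. [cite: Deligne1982HodgeCycles, §4 p. 30 (1) and Cor. 4.2] -/
theorem zeta12_mk_eleven_mul_ne_splitDiscriminantClassCM {R : Polynomial ℤ}
    (hR : R = X ^ 2 + C 8 * X + C 4) [Fact (Irreducible (realPolyQ R))] (w : ℤ) (hw : ¬ (11 : ℤ) ∣ w)
    (u : (realField R)ˣ) (hu : (u : realField R) = AdjoinRoot.of (realPolyQ R) (11 * w)) :
    (QuotientGroup.mk u : cmNormResidueGroup R) ≠ splitDiscriminantClassCM R 2 := by
  exact mk_prime_mul_ne_splitDiscriminantClassCM_of_two_roots hR (by norm_num) (by norm_num)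
    disc_not_sq_eight_four 11 (by norm_num) 8 6 (by decide) (by decide) (by decide) (by decide) (by decide) w hw u
    (by rw [hu]; push_cast; ring_nf)

/-- **`[23w] ≠ [1]` for `E = ℚ(ζ₁₂)`, `23 ∤ w`** (`σ ≡ 10, 5 mod 23`, non-squares): census row `[23]`.
[cite: Deligne1982HodgeCycles, §4 p. 30 (1) and Cor. 4.2] -/
theorem zeta12_mk_twentyThree_mul_ne_splitDiscriminantClassCM {R : Polynomial ℤ}
    (hR : R = X ^ 2 + C 8 * X + C 4) [Fact (Irreducible (realPolyQ R))] (w : ℤ) (hw : ¬ (23 : ℤ) ∣ w)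
    (u : (realField R)ˣ) (hu : (u : realField R) = AdjoinRoot.of (realPolyQ R) (23 * w)) :
    (QuotientGroup.mk u : cmNormResidueGroup R) ≠ splitDiscriminantClassCM R 2 := by
  exact mk_prime_mul_ne_splitDiscriminantClassCM_of_two_roots hR (by norm_num) (by norm_num)
    disc_not_sq_eight_four 23 (by norm_num) 10 5 (by decide) (by decide) (by decide) (by decide) (by decide) w hw u
    (by rw [hu]; push_cast; ring_nf)

/-! ### §4 `E = ℚ(√-3,√5)`: `R = S² + 9S + 9` (`η = √-3(1+√5)/2`), `F = ℚ(√5)`; `ℓ = 11, 29` -/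

/-- **`[11w] ≠ [1]` for `E = ℚ(√-3,√5)`, `11 ∤ w`** (`σ ≡ 7, 6 mod 11`, non-squares): census rows `[11]`,
`[22]`, `[33]`. [cite: Deligne1982HodgeCycles, §4 p. 30 (1) and Cor. 4.2] -/
theorem sqrtNeg3Sqrt5_mk_eleven_mul_ne_splitDiscriminantClassCM {R : Polynomial ℤ}
    (hR : R = X ^ 2 + C 9 * X + C 9) [Fact (Irreducible (realPolyQ R))] (w : ℤ) (hw : ¬ (11 : ℤ) ∣ w)
    (u : (realField R)ˣ) (hu : (u : realField R) = AdjoinRoot.of (realPolyQ R) (11 * w)) :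
    (QuotientGroup.mk u : cmNormResidueGroup R) ≠ splitDiscriminantClassCM R 2 := by
  exact mk_prime_mul_ne_splitDiscriminantClassCM_of_two_roots hR (by norm_num) (by norm_num)
    disc_not_sq_nine_nine 11 (by norm_num) 7 6 (by decide) (by decide) (by decide) (by decide) (by decide) w hw u
    (by rw [hu]; push_cast; ring_nf)

/-- **`[29w] ≠ [1]` for `E = ℚ(√-3,√5)`, `29 ∤ w`** (`σ ≡ 12, 8 mod 29`, non-squares): census row `[29]`.
[cite: Deligne1982HodgeCycles, §4 p. 30 (1) and Cor. 4.2] -/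
theorem sqrtNeg3Sqrt5_mk_twentyNine_mul_ne_splitDiscriminantClassCM {R : Polynomial ℤ}
    (hR : R = X ^ 2 + C 9 * X + C 9) [Fact (Irreducible (realPolyQ R))] (w : ℤ) (hw : ¬ (29 : ℤ) ∣ w)
    (u : (realField R)ˣ) (hu : (u : realField R) = AdjoinRoot.of (realPolyQ R) (29 * w)) :
    (QuotientGroup.mk u : cmNormResidueGroup R) ≠ splitDiscriminantClassCM R 2 := by
  exact mk_prime_mul_ne_splitDiscriminantClassCM_of_two_roots hR (by norm_num) (by norm_num)
    disc_not_sq_nine_nine 29 (by norm_num) 12 8 (by decide) (by decide) (by decide) (by decide) (by decide) w hw u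
    (by rw [hu]; push_cast; ring_nf)

/-! ### §5 `E = ℚ(i,√5)`: `R = S² + 3S + 1` (`η = i(1+√5)/2`), `F = ℚ(√5)`; `ℓ = 11, 19, 31` -/

/-- **`[11w] ≠ [1]` for `E = ℚ(i,√5)`, `11 ∤ w`** (`σ ≡ 6, 2 mod 11`, non-squares): census rows `[11]`, `[22]`,
`[33]`. [cite: Deligne1982HodgeCycles, §4 p. 30 (1) and Cor. 4.2] -/
theorem sqrtNeg1Sqrt5_mk_eleven_mul_ne_splitDiscriminantClassCM {R : Polynomial ℤ}
    (hR : R = X ^ 2 + C 3 * X + C 1) [Fact (Irreducible (realPolyQ R))] (w : ℤ) (hw : ¬ (11 : ℤ) ∣ w)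
    (u : (realField R)ˣ) (hu : (u : realField R) = AdjoinRoot.of (realPolyQ R) (11 * w)) :
    (QuotientGroup.mk u : cmNormResidueGroup R) ≠ splitDiscriminantClassCM R 2 := by
  exact mk_prime_mul_ne_splitDiscriminantClassCM_of_two_roots hR (by norm_num) (by norm_num)
    disc_not_sq_three_one 11 (by norm_num) 6 2 (by decide) (by decide) (by decide) (by decide) (by decide) w hw u
    (by rw [hu]; push_cast; ring_nf)

/-- **`[19w] ≠ [1]` for `E = ℚ(i,√5)`, `19 ∤ w`** (`σ ≡ 3, 13 mod 19`, non-squares): census rows `[19]`,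
`[38]`. [cite: Deligne1982HodgeCycles, §4 p. 30 (1) and Cor. 4.2] -/
theorem sqrtNeg1Sqrt5_mk_nineteen_mul_ne_splitDiscriminantClassCM {R : Polynomial ℤ}
    (hR : R = X ^ 2 + C 3 * X + C 1) [Fact (Irreducible (realPolyQ R))] (w : ℤ) (hw : ¬ (19 : ℤ) ∣ w)
    (u : (realField R)ˣ) (hu : (u : realField R) = AdjoinRoot.of (realPolyQ R) (19 * w)) :
    (QuotientGroup.mk u : cmNormResidueGroup R) ≠ splitDiscriminantClassCM R 2 := by
  exact mk_prime_mul_ne_splitDiscriminantClassCM_of_two_roots hR (by norm_num) (by norm_num)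
    disc_not_sq_three_one 19 (by norm_num) 3 13 (by decide) (by decide) (by decide) (by decide) (by decide) w hw u
    (by rw [hu]; push_cast; ring_nf)

/-- **`[31w] ≠ [1]` for `E = ℚ(i,√5)`, `31 ∤ w`** (`σ ≡ 17, 11 mod 31`, non-squares): census row `[31]`.
[cite: Deligne1982HodgeCycles, §4 p. 30 (1) and Cor. 4.2] -/
theorem sqrtNeg1Sqrt5_mk_thirtyOne_mul_ne_splitDiscriminantClassCM {R : Polynomial ℤ}
    (hR : R = X ^ 2 + C 3 * X + C 1) [Fact (Irreducible (realPolyQ R))] (w : ℤ) (hw : ¬ (31 : ℤ) ∣ w)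
    (u : (realField R)ˣ) (hu : (u : realField R) = AdjoinRoot.of (realPolyQ R) (31 * w)) :
    (QuotientGroup.mk u : cmNormResidueGroup R) ≠ splitDiscriminantClassCM R 2 := by
  exact mk_prime_mul_ne_splitDiscriminantClassCM_of_two_roots hR (by norm_num) (by norm_num)
    disc_not_sq_three_one 31 (by norm_num) 17 11 (by decide) (by decide) (by decide) (by decide) (by decide) w hw u
    (by rw [hu]; push_cast; ring_nf)

/-! ### §6 Unconditional packagings (the `Fact` supplied by factor exclusion: `R` literal, least representative of the row) -/

/-- **`[7] ≠ [1]` for `ℚ(ζ₈)`** with `R = S² + 6S + 1` LITERALLY (census row `W8.ℚ(ζ₈).{(7,√2−3),(7,√2+3)}`,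
least representative `7`). [cite: Deligne1982HodgeCycles, §4 p. 30 (1) and Cor. 4.2] -/
theorem zeta8_seven_nonsplit :
    haveI := fact_irreducible_realPolyQ_of_not_sq (R := X ^ 2 + C 6 * X + C 1) rfl disc_not_sq_six_one
    ∀ u : (realField (X ^ 2 + C 6 * X + C 1))ˣ, (u : realField (X ^ 2 + C 6 * X + C 1)) = 7 →
      (QuotientGroup.mk u : cmNormResidueGroup (X ^ 2 + C 6 * X + C 1)) ≠
        splitDiscriminantClassCM (X ^ 2 + C 6 * X + C 1) 2 := by
  haveI := fact_irreducible_realPolyQ_of_not_sq (R := X ^ 2 + C 6 * X + C 1) rfl disc_not_sq_six_one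
  exact fun u hu => zeta8_mk_seven_mul_ne_splitDiscriminantClassCM rfl 1 (by norm_num) u (by rw [hu]; simp)

/-- **`[11] ≠ [1]` for `ℚ(ζ₁₂)`** with `R = S² + 8S + 4` LITERALLY (least representative `11` of the row
`{(11,√3−5),(11,√3+5)}`; `E/F` is unramified at every finite place, so EVERY non-split row of this field is
of the split-prime kind). [cite: Deligne1982HodgeCycles, §4 p. 30 (1) and Cor. 4.2] -/
theorem zeta12_eleven_nonsplit :
    haveI := fact_irreducible_realPolyQ_of_not_sq (R := X ^ 2 + C 8 * X + C 4) rfl disc_not_sq_eight_four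
    ∀ u : (realField (X ^ 2 + C 8 * X + C 4))ˣ, (u : realField (X ^ 2 + C 8 * X + C 4)) = 11 →
      (QuotientGroup.mk u : cmNormResidueGroup (X ^ 2 + C 8 * X + C 4)) ≠
        splitDiscriminantClassCM (X ^ 2 + C 8 * X + C 4) 2 := by
  haveI := fact_irreducible_realPolyQ_of_not_sq (R := X ^ 2 + C 8 * X + C 4) rfl disc_not_sq_eight_four
  exact fun u hu => zeta12_mk_eleven_mul_ne_splitDiscriminantClassCM rfl 1 (by norm_num) u (by rw [hu]; simp)

/-- **`[11] ≠ [1]` for `ℚ(√-3,√5)`** with `R = S² + 9S + 9` LITERALLY. [cite: Deligne1982HodgeCycles, §4 p. 30 (1) and Cor. 4.2] -/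
theorem sqrtNeg3Sqrt5_eleven_nonsplit :
    haveI := fact_irreducible_realPolyQ_of_not_sq (R := X ^ 2 + C 9 * X + C 9) rfl disc_not_sq_nine_nine
    ∀ u : (realField (X ^ 2 + C 9 * X + C 9))ˣ, (u : realField (X ^ 2 + C 9 * X + C 9)) = 11 →
      (QuotientGroup.mk u : cmNormResidueGroup (X ^ 2 + C 9 * X + C 9)) ≠
        splitDiscriminantClassCM (X ^ 2 + C 9 * X + C 9) 2 := by
  haveI := fact_irreducible_realPolyQ_of_not_sq (R := X ^ 2 + C 9 * X + C 9) rfl disc_not_sq_nine_nine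
  exact fun u hu => sqrtNeg3Sqrt5_mk_eleven_mul_ne_splitDiscriminantClassCM rfl 1 (by norm_num) u (by rw [hu]; simp)

/-- **`[11] ≠ [1]` for `ℚ(i,√5)`** with `R = S² + 3S + 1` LITERALLY. [cite: Deligne1982HodgeCycles, §4 p. 30 (1) and Cor. 4.2] -/
theorem sqrtNeg1Sqrt5_eleven_nonsplit :
    haveI := fact_irreducible_realPolyQ_of_not_sq (R := X ^ 2 + C 3 * X + C 1) rfl disc_not_sq_three_one
    ∀ u : (realField (X ^ 2 + C 3 * X + C 1))ˣ, (u : realField (X ^ 2 + C 3 * X + C 1)) = 11 →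
      (QuotientGroup.mk u : cmNormResidueGroup (X ^ 2 + C 3 * X + C 1)) ≠
        splitDiscriminantClassCM (X ^ 2 + C 3 * X + C 1) 2 := by
  haveI := fact_irreducible_realPolyQ_of_not_sq (R := X ^ 2 + C 3 * X + C 1) rfl disc_not_sq_three_one
  exact fun u hu => sqrtNeg1Sqrt5_mk_eleven_mul_ne_splitDiscriminantClassCM rfl 1 (by norm_num) u (by rw [hu]; simp)

end Summit.HodgeConjecture.HodgeConjecture.Ring2.WeilCoverageCM

end
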